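import Summits.QuantumFields.BalabanUV.Beta.GAN24.DirichletVertexDist

/-!
# `BalabanUV.Beta.GAN24.DirichletVertexDistV` — binder row G-an2-4 / (CONV-C), road P2 PART IV, leaf L14 (the torus transfer), FILE C6a′:
# THE DISTANCE `r_V` TO A FAMILY OF BLOCK VERTICES and the two-sided comparison `n/r_V ≤ ω_V⁻¹ ≤ (1+|V|)·n/r_V`
# (unit b2b-balaban-gan24-p2, gen 27, v1)

HONEST FRAMING (cell contract, verbatim): «discharging `BetaPertH` makes Bałaban's UV stability UNCONDITIONAL — a real constructive-QFT
result; it is NOT the continuum limit and NOT the Clay problem.»  SUPPLIER module under the T⁴-DAG sub-row `T4-U1a.S-NE2-D1-DIRICHLET°`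
(owner wording R24 «the full rate L⁻¹ beyond boxes OPEN»).  Continuation of `DirichletVertexDist` (torus ring index `ρ̂_b`, its Lipschitz
property, `invW_{(σ,b)} = [ρ̂_b ≤ n−1]·n/ρ̂_b`): for a finite family `V` of vertices put `r_V(x) = min(n, min_{v∈V} ρ̂_v(x))`; then `r_V` is
1-Lipschitz along lattice rays and the coarse weight `ω_V` of `DirichletVertexEnergy` (p244737) satisfies `n/r_V ≤ ω_V⁻¹ ≤ (1+|V|)·n/r_V`
— the only input of the ray schedule of the flux binders (Φ), (Φ′) (next file).

## Contents ([folklore]; 0 sorry)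
* `rV = V.fold min n ρ̂`, `1 ≤ r_V ≤ n`, `r_V ≤ ρ̂_v`, attainment, Lipschitz under `± tstep μ m` and `− e_μ`;
* **`sum_invW_le`** / **`le_sum_invW`**: `n/r_V − 1 ≤ Σ_v invW_v ≤ |V|·n/r_V`; **`le_inv_omegaV`**, **`inv_omegaV_le`**, `omegaV_le`, `le_omegaV`.

ABSOLUTE RULE (cell, verbatim): «No internally-minted statement may enter as a cited fact. Every hypothesis is either kernel-proved in
this package or a verbatim quotation of a PUBLISHED theorem with page reference. The manuscript(s) under audit are NOT citable for
their own disputed steps — they are the thing under adjudication; programme-internal (2001/route/tribunal) claims are never citable.»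
Nothing printed is a hypothesis.  NOT CLAIMED: (Φ)/(Φ′), (A′), the END (p234489 stays CONDITIONAL); NOT NE2, (CONV-C), `BetaPertH`,
continuum, Clay.  «not in print; our proof attempt».  HONEST DEPENDENCY: continuum YM on T⁴ ⇐ BetaPertH ∧ nine spine estimates (0/9
proved); BetaPertH ⇐ (D1) ∧ (D4) ∧ CAP+tail; G-an2-4 gates asym, D1 and NE2/3/4.
-/

noncomputable section

open scoped BigOperators
open Finset

namespace Summit.QuantumFields.BalabanUV.Beta.GAN24.DirichletVertexDistV

open Literature.MathematicalPhysics.QuantumFieldTheory.Balaban1983to89.B5Prop11Plancherel (Tor fine unitVec)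
open Literature.MathematicalPhysics.QuantumFieldTheory.Balaban1983to89.B5Block118 (tstep)
open DirichletVertexChart
open DirichletVertexEnergy (invW omegaV invW_nonneg omegaV_pos inv_omegaV)
open DirichletVertexDist

variable (n : ℕ) [NeZero n] (M : Fin 2 → ℕ) [hM : ∀ μ, NeZero (M μ)]

/-! ## §3 The distance to a family of vertices and the comparison with `ω_V` -/

section Family

variable (V : Finset ((Fin 2 → Bool) × Tor M))

/-- the DISTANCE TO THE FAMILY `V`, capped at `n`: `r_V(x) = min(n, min_{v∈V} ρ̂_{v}(x))`. [folklore] -/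
def rV (x : Tor (fine n M)) : ℕ := V.fold min n (fun v => rhoT n M v.2 x)

omit [NeZero n] hM in
/-- `r_V ≤ n`. [folklore] -/
theorem rV_le_n (x : Tor (fine n M)) : rV n M V x ≤ n := (Finset.fold_min_le _).mpr (Or.inl le_rfl)

omit [NeZero n] hM in
/-- `r_V ≤ ρ̂_v` for `v ∈ V`. [folklore] -/
theorem rV_le_rhoT {v : (Fin 2 → Bool) × Tor M} (hv : v ∈ V) (x : Tor (fine n M)) : rV n M V x ≤ rhoT n M v.2 x :=
  (Finset.fold_min_le _).mpr (Or.inr ⟨v, hv, le_rfl⟩)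

/-- `1 ≤ r_V` (`1 ≤ n`). [folklore] -/
theorem one_le_rV (x : Tor (fine n M)) : 1 ≤ rV n M V x :=
  (Finset.le_fold_min _).mpr ⟨Nat.pos_of_ne_zero (NeZero.ne n), fun v _ => one_le_rhoT n M v.2 x⟩

omit [NeZero n] hM in
/-- attainment: `r_V = n` or `r_V = ρ̂_v` for some `v ∈ V`. [folklore] -/
theorem rV_eq (x : Tor (fine n M)) : rV n M V x = n ∨ ∃ v ∈ V, rV n M V x = rhoT n M v.2 x := by
  rcases (Finset.fold_min_le _).mp (le_refl (rV n M V x)) with h | ⟨v, hv, h⟩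
  · exact Or.inl (le_antisymm (rV_le_n n M V x) h)
  · exact Or.inr ⟨v, hv, le_antisymm (rV_le_rhoT n M V hv x) h⟩

omit [NeZero n] hM in
/-- if every `ρ̂_v(y)` is at most `ρ̂_v(x) + m`, then `r_V(y) ≤ r_V(x) + m`. [folklore] -/
theorem rV_le_of {x y : Tor (fine n M)} {m : ℕ} (h : ∀ v ∈ V, rhoT n M v.2 y ≤ rhoT n M v.2 x + m) : rV n M V y ≤ rV n M V x + m := by
  rcases rV_eq n M V x with hx | ⟨v, hv, hx⟩
  · rw [hx]; exact (rV_le_n n M V y).trans (Nat.le_add_right _ _)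
  · rw [hx]; exact (rV_le_rhoT n M V hv y).trans (h v hv)

/-- **LIPSCHITZ OF `r_V`** under `m` steps forward … [folklore] -/
theorem rV_add_tstep_le (μ : Fin 2) (x : Tor (fine n M)) (m : ℕ) :
    rV n M V (x + tstep (fine n M) μ m) ≤ rV n M V x + m ∧ rV n M V x ≤ rV n M V (x + tstep (fine n M) μ m) + m :=
  ⟨rV_le_of n M V fun v _ => (rhoT_add_tstep_le n M v.2 μ x m).1, rV_le_of n M V fun v _ => (rhoT_add_tstep_le n M v.2 μ x m).2⟩

/-- … backward … [folklore] -/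
theorem rV_sub_tstep_le (μ : Fin 2) (x : Tor (fine n M)) (m : ℕ) :
    rV n M V (x - tstep (fine n M) μ m) ≤ rV n M V x + m ∧ rV n M V x ≤ rV n M V (x - tstep (fine n M) μ m) + m :=
  ⟨rV_le_of n M V fun v _ => (rhoT_sub_tstep_le n M v.2 μ x m).1, rV_le_of n M V fun v _ => (rhoT_sub_tstep_le n M v.2 μ x m).2⟩

/-- … and under one unit step backward. [folklore] -/
theorem rV_sub_unitVec_le (μ : Fin 2) (x : Tor (fine n M)) :
    rV n M V (x - unitVec (fine n M) μ) ≤ rV n M V x + 1 ∧ rV n M V x ≤ rV n M V (x - unitVec (fine n M) μ) + 1 :=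
  ⟨rV_le_of n M V fun v _ => (rhoT_sub_unitVec_le n M v.2 μ x).1, rV_le_of n M V fun v _ => (rhoT_sub_unitVec_le n M v.2 μ x).2⟩

/-- **THE UPPER COMPARISON** `Σ_{v∈V} invW_v(x) ≤ |V|·n/r_V(x)` (`2 ≤ n`, `M_ν ≥ 2`). [folklore] -/
theorem sum_invW_le (hn : 2 ≤ n) (hM2 : ∀ ν, 2 ≤ M ν) (x : Tor (fine n M)) :
    ∑ v ∈ V, invW n M v (n - 1) x ≤ V.card * ((n : ℝ) / rV n M V x) := by
  have hr : (0 : ℝ) < rV n M V x := by exact_mod_cast one_le_rV n M V x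
  calc ∑ v ∈ V, invW n M v (n - 1) x ≤ ∑ v ∈ V, (n : ℝ) / rV n M V x := by
        refine sum_le_sum fun v hv => ?_
        have h := invW_le n M (σ := v.1) (b := v.2) hn hM2 x
        refine h.trans (div_le_div_of_nonneg_left (Nat.cast_nonneg _) hr ?_)
        exact_mod_cast rV_le_rhoT n M V hv x
    _ = V.card * ((n : ℝ) / rV n M V x) := by rw [sum_const, nsmul_eq_mul]

/-- **THE LOWER COMPARISON** `n/r_V(x) − 1 ≤ Σ_{v∈V} invW_v(x)`. [folklore] -/
theorem le_sum_invW (x : Tor (fine n M)) :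
    (n : ℝ) / rV n M V x - 1 ≤ ∑ v ∈ V, invW n M v (n - 1) x := by
  have hsum : 0 ≤ ∑ v ∈ V, invW n M v (n - 1) x := sum_nonneg fun v _ => invW_nonneg n M v _ x
  rcases rV_eq n M V x with h | ⟨v, hv, h⟩
  · rw [h, div_self (by exact_mod_cast NeZero.ne n)]; linarith
  · -- `r_V = ρ̂_v ≤ n`; if `= n` as before, else the lower bridge at `v`
    rcases Nat.lt_or_ge (rV n M V x) n with hlt | hge
    · have hle : rhoT n M v.2 x ≤ n - 1 := by rw [← h]; omega
      have h1 := le_invW n M (σ := v.1) (b := v.2) hle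
      rw [h]
      calc (n : ℝ) / rhoT n M v.2 x - 1 ≤ (n : ℝ) / rhoT n M v.2 x := by linarith
        _ ≤ invW n M (v.1, v.2) (n - 1) x := h1
        _ ≤ ∑ v ∈ V, invW n M v (n - 1) x := single_le_sum (f := fun v => invW n M v (n - 1) x) (fun v _ => invW_nonneg n M v _ x) hv
    · have heq : rV n M V x = n := le_antisymm (rV_le_n n M V x) hge
      rw [heq, div_self (by exact_mod_cast NeZero.ne n)]; linarith

/-- **`n/r_V ≤ ω_V⁻¹`**. [folklore] -/
theorem le_inv_omegaV (x : Tor (fine n M)) : (n : ℝ) / rV n M V x ≤ (omegaV n M V (n - 1) x)⁻¹ := by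
  rw [inv_omegaV]
  linarith [le_sum_invW n M V x]

/-- **`ω_V⁻¹ ≤ (1 + |V|)·n/r_V`** (`2 ≤ n`, `M_ν ≥ 2`). [folklore] -/
theorem inv_omegaV_le (hn : 2 ≤ n) (hM2 : ∀ ν, 2 ≤ M ν) (x : Tor (fine n M)) :
    (omegaV n M V (n - 1) x)⁻¹ ≤ (1 + V.card) * ((n : ℝ) / rV n M V x) := by
  rw [inv_omegaV]
  have h := sum_invW_le n M V hn hM2 x
  have h1 : (1 : ℝ) ≤ (n : ℝ) / rV n M V x := by
    rw [le_div_iff₀ (by exact_mod_cast one_le_rV n M V x), one_mul]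
    exact_mod_cast rV_le_n n M V x
  linarith

/-- equivalently `ω_V ≤ r_V/n` … [folklore] -/
theorem omegaV_le (x : Tor (fine n M)) : omegaV n M V (n - 1) x ≤ (rV n M V x : ℝ) / n := by
  have hω := omegaV_pos n M V (n - 1) x
  have hn : (0 : ℝ) < n := by exact_mod_cast Nat.pos_of_ne_zero (NeZero.ne n)
  have hr : (0 : ℝ) < rV n M V x := by exact_mod_cast one_le_rV n M V x
  have h := le_inv_omegaV n M V x
  rw [div_le_iff₀ hr] at h
  rw [le_div_iff₀ hn]
  calc omegaV n M V (n - 1) x * n ≤ omegaV n M V (n - 1) x * ((omegaV n M V (n - 1) x)⁻¹ * rV n M V x) :=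
        mul_le_mul_of_nonneg_left h hω.le
    _ = rV n M V x := by rw [← mul_assoc, mul_inv_cancel₀ hω.ne', one_mul]

/-- … and `r_V/((1+|V|)·n) ≤ ω_V`. [folklore] -/
theorem le_omegaV (hn : 2 ≤ n) (hM2 : ∀ ν, 2 ≤ M ν) (x : Tor (fine n M)) :
    (rV n M V x : ℝ) / ((1 + V.card) * n) ≤ omegaV n M V (n - 1) x := by
  have hω := omegaV_pos n M V (n - 1) x
  have hn' : (0 : ℝ) < n := by exact_mod_cast Nat.pos_of_ne_zero (NeZero.ne n)
  have hr : (0 : ℝ) < rV n M V x := by exact_mod_cast one_le_rV n M V x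
  have hV : (0 : ℝ) < 1 + V.card := by positivity
  have h := inv_omegaV_le n M V hn hM2 x
  rw [div_le_iff₀ (by positivity)]
  have h2 : (omegaV n M V (n - 1) x)⁻¹ * rV n M V x ≤ (1 + V.card) * n := by
    have := mul_le_mul_of_nonneg_right h hr.le
    rwa [mul_div_assoc', div_mul_cancel₀ _ hr.ne'] at this
  calc (rV n M V x : ℝ) = omegaV n M V (n - 1) x * ((omegaV n M V (n - 1) x)⁻¹ * rV n M V x) := by
        rw [← mul_assoc, mul_inv_cancel₀ hω.ne', one_mul]
    _ ≤ omegaV n M V (n - 1) x * ((1 + V.card) * n) := mul_le_mul_of_nonneg_left h2 hω.le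

end Family

end Summit.QuantumFields.BalabanUV.Beta.GAN24.DirichletVertexDistV

end
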